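import Literature.Combinatorics.Hypergraph.FGKMTCoveringNibbleKit
import HarnessLib

/-!
# Ford–Green–Konyagin–Maynard–Tao 2018, §5: one nibble — data, Lemma 5.1, the conditional laws

Topic `Literature/Combinatorics/Hypergraph`. Source: K. Ford, B. Green, S. Konyagin, J. Maynard, T. Tao,
*Long gaps between primes*, J. Amer. Math. Soc. 31 (2018) 65–105 = arXiv:1412.5029
[FordGreenKonyaginMaynardTao2018], §5 «Proof of covering theorem», pp. 19–21 (arXiv pp. 14–15):
the inductive step `m − 1 → m` of the proof of Theorem 3 (`FGKMT2018_theorem3`).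

This file sets up ONE NIBBLE as a structure `NibbleData` (the block `I_m`, the laws of the `𝐞_i`, the
weights `P_{m−1}`, the previous stage as a finite law carrying `𝐖`, the induction hypothesis (5.2), and
the explicit smallness that (4.5) provides), and PROVES, with explicit constants in place of the paper's
`O(·)`:
* **Lemma 5.1** — `E X_i(𝐖) = 1 + O_≤(η)` ((5.4)), `E X_i(𝐖)² ≤ (1 + η)(1 + κ^{-r}rδ)` ((5.5)), hence
  `E (X_i − 1)² ≤ 3η + 2κ^{-r}rδ` and, by Chebyshev (Lemma 4.1), `P(F_i fails) ≤ φ = (3η + 2κ^{-r}rδ)/t²`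
  with the threshold `t = η^{1/3} = δ^{1/(3·10^m)}` of the event `F_i = {|X_i − 1| ≤ t}`;
* the conditional laws (5.3) `q_i(· | W)` of the `𝐞'_i` are probability laws supported in the essential
  range of `𝐞_i` union `{∅}` (conclusion (a) of Theorem 3), dominated by `2κ^{-r} P(𝐞_i = ·)` on `F_i`.

Here `η = δ^{1/10^m}` is the relative error of the induction hypothesis and `u = η^{1/6}` the basic
small parameter (`t = u²`); the assembled one-step estimate and the induction over `m` are in the sequel
files.
-/

noncomputable section

open Finset

namespace Literature.Combinatorics.Hypergraph

namespace FGKMTCovering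

/-! ## One nibble (the inductive step `m − 1 → m` of §5): data, hypotheses, normalisation -/

/-- **The data and hypotheses of one nibble** (the inductive step of §5, arXiv p. 14), in the
law-based rendering of `FGKMTProbabilisticCovering`: the index block `T = I_m`; the laws `μ i` of the
`𝐞_i` (`i ∈ I_m`) with (4.6) `#𝐞_i ≤ r`, (4.7) `P(v ∈ 𝐞_i) ≤ δ`, (4.8) `∑_i P(v, w ∈ 𝐞_i) ≤ δ`;
the weights `p(v) = P_{m−1}(v) ∈ [κ, 1]` with (4.12) `d_{I_m}(v) ≤ D p(v)` and `P_{m−1}(ẽ) ≥ θ := κ^r` on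
the essential range of `𝐞_i` ((5.1)); the previous stage as a law `Λ` on a finite type `Ω` carrying the
partially sifted set `𝐖 = W(ω)`, with the INDUCTION HYPOTHESIS (5.2)
`P(e ⊆ 𝐖) = (1 + O_≤(η)) P_{m−1}(e)` for `#e ≤ s + 2r` (`s = A − 2rm`, `η = δ^{1/10^m}`); and the size
parameter `G ≥ A, D, r, κ^{-r}, e^{sD}, 1/P_{m−1}(e)` with the smallness `δ ≤ η^{10}`, `G^{18} η ≤ 10^{-12}`
that (4.5) provides (display after (5.1): «`rκ^{-r} ≤ Aκ^{-r} ≤ A²κ^{-2r} ≤ A²Dκ^{-A} ≤ δ^{-1/10^{m+2}}`»).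
[cite: FordGreenKonyaginMaynardTao2018, §5 (inductive step), (5.1)–(5.2), (4.5)–(4.13)] -/
structure NibbleData (V ι Ω : Type*) [Fintype V] [DecidableEq V] [Fintype Ω] where
  /-- the block `I_m` of indices treated in this nibble -/
  T : Finset ι
  /-- the laws of the random sets `𝐞_i` -/
  μ : ι → Finset V → ℝ
  /-- the weights `p(v) = P_{m-1}(v)` -/
  p : V → ℝ
  /-- the law of the previous stage -/
  Λ : Ω → ℝ
  /-- the partially sifted set `𝐖` as a function of the previous stage -/
  W : Ω → Finset V
  /-- edge size bound (4.6) -/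
  r : ℝ
  /-- size bound for the sets `e` treated at this level (`A − 2rm`) -/
  s : ℝ
  /-- sparsity (4.7)–(4.8) -/
  δ : ℝ
  /-- relative error of the induction hypothesis (`δ^{1/10^m}`) -/
  η : ℝ
  /-- lower bound (4.13) for the weights -/
  κ : ℝ
  /-- lower bound `κ^r` for `P_{m-1}` on edges ((5.1)) -/
  θ : ℝ
  /-- degree bound (4.12) -/
  D : ℝ
  /-- common upper bound for `A, D, r, κ^{-r}, e^{sD}, 1/P_{m-1}(e)` -/
  G : ℝ
  hlaw : ∀ i ∈ T, IsLaw (μ i)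
  hsize : ∀ i ∈ T, ∀ S : Finset V, μ i S ≠ 0 → (#S : ℝ) ≤ r
  hsparse : ∀ i ∈ T, ∀ v : V, probMem (μ i) v ≤ δ
  hcodeg : ∀ v w : V, v ≠ w → ∑ i ∈ T, probPairMem (μ i) v w ≤ δ
  hdeg : ∀ v : V, normDegree μ T v ≤ D * p v
  hpκ : ∀ v : V, κ ≤ p v
  hp1 : ∀ v : V, p v ≤ 1
  hθ : ∀ i ∈ T, ∀ S : Finset V, μ i S ≠ 0 → θ ≤ pw p S
  hθκ : θ ≤ κ
  hΛ : IsLaw Λ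
  hhyp : ∀ e : Finset V, (#e : ℝ) ≤ s + 2 * r →
    |(∑ ω, Λ ω * if e ⊆ W ω then (1 : ℝ) else 0) - pw p e| ≤ η * pw p e
  hr : 1 ≤ r
  hs : 0 ≤ s
  hδ : 0 < δ
  hη0 : 0 < η
  hκ : 0 < κ
  hθ0 : 0 < θ
  hD : 1 ≤ D
  hG : 1 ≤ G
  hsG : s ≤ G
  hDG : D ≤ G
  hrG : r ≤ G
  hθG : θ⁻¹ ≤ G
  hexpG : Real.exp (s * D) ≤ G
  hPG : ∀ e : Finset V, (#e : ℝ) ≤ s → 1 / pw p e ≤ G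
  hδη : δ ≤ η ^ 10
  hGη : G ^ 18 * η * 10 ^ 12 ≤ 1

namespace NibbleData

variable {V ι Ω : Type*} [Fintype V] [DecidableEq V] [Fintype Ω] (𝔑 : NibbleData V ι Ω)

/-! ### Bookkeeping -/

/-- [cite: FordGreenKonyaginMaynardTao2018, (4.6)–(4.8)] -/
theorem μ_nonneg {i : ι} (hi : i ∈ 𝔑.T) (S : Finset V) : 0 ≤ 𝔑.μ i S := (𝔑.hlaw i hi).1 S

/-- [cite: FordGreenKonyaginMaynardTao2018, (4.6)–(4.8)] -/
theorem μ_sum {i : ι} (hi : i ∈ 𝔑.T) : ∑ S, 𝔑.μ i S = 1 := (𝔑.hlaw i hi).2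

/-- [cite: FordGreenKonyaginMaynardTao2018, (4.13)] -/
theorem p_pos (v : V) : 0 < 𝔑.p v := lt_of_lt_of_le 𝔑.hκ (𝔑.hpκ v)

/-- `P(S) = P_{m−1}(S)`. [cite: FordGreenKonyaginMaynardTao2018, (4.14)] -/
def P (S : Finset V) : ℝ := pw 𝔑.p S

/-- [cite: FordGreenKonyaginMaynardTao2018, (4.13)–(4.14)] -/
theorem P_pos (S : Finset V) : 0 < 𝔑.P S := pw_pos 𝔑.p_pos S

/-- [cite: FordGreenKonyaginMaynardTao2018, (4.14)] -/
theorem P_le_one (S : Finset V) : 𝔑.P S ≤ 1 := pw_le_one (fun v => (𝔑.p_pos v).le) 𝔑.hp1 S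

/-- [cite: FordGreenKonyaginMaynardTao2018, (4.14)] -/
theorem P_anti {S S' : Finset V} (h : S ⊆ S') : 𝔑.P S' ≤ 𝔑.P S :=
  pw_anti (fun v => (𝔑.p_pos v).le) 𝔑.hp1 h

/-- [cite: FordGreenKonyaginMaynardTao2018, (4.14)] -/
theorem P_union_inter (S S' : Finset V) : 𝔑.P (S ∪ S') * 𝔑.P (S ∩ S') = 𝔑.P S * 𝔑.P S' :=
  pw_union_inter 𝔑.p S S'

/-- `P(X) ≥ θ` for `X` inside an edge of the essential range ((5.1) «`P_j(ẽ) ≥ κ^r`»).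
[cite: FordGreenKonyaginMaynardTao2018, §5 (5.1)] -/
theorem θ_le_P {i : ι} (hi : i ∈ 𝔑.T) {S X : Finset V} (hS : 𝔑.μ i S ≠ 0) (hX : X ⊆ S) :
    𝔑.θ ≤ 𝔑.P X :=
  (𝔑.hθ i hi S hS).trans (𝔑.P_anti hX)

/-- [cite: FordGreenKonyaginMaynardTao2018, (4.5)] -/
theorem η_le : 𝔑.η ≤ 1 / 10 ^ 12 := by
  have h1 : (1 : ℝ) ≤ 𝔑.G ^ 18 := one_le_pow₀ 𝔑.hG
  have h2 := 𝔑.hGη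
  rw [le_div_iff₀ (by norm_num)]
  nlinarith [𝔑.hη0]

/-- [cite: FordGreenKonyaginMaynardTao2018, (4.5)] -/
theorem η_le_one : 𝔑.η ≤ 1 := 𝔑.η_le.trans (by norm_num)

/-- [cite: FordGreenKonyaginMaynardTao2018, (4.5)] -/
theorem δ_le_η : 𝔑.δ ≤ 𝔑.η :=
  𝔑.hδη.trans (pow_le_of_le_one 𝔑.hη0.le 𝔑.η_le_one (by norm_num))

/-- [cite: FordGreenKonyaginMaynardTao2018, (4.5)] -/
theorem Gη_le : 𝔑.G * 𝔑.η ≤ 1 / 10 ^ 12 := by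
  have h1 : 𝔑.G ≤ 𝔑.G ^ 18 := le_self_pow₀ 𝔑.hG (by norm_num)
  have h2 := 𝔑.hGη
  rw [le_div_iff₀ (by norm_num)]
  nlinarith [𝔑.hη0, mul_le_mul_of_nonneg_right h1 𝔑.hη0.le]

/-- [cite: FordGreenKonyaginMaynardTao2018, (4.5)] -/
theorem Gsqη_le : 𝔑.G ^ 2 * 𝔑.η ≤ 1 / 10 ^ 12 := by
  have h1 : 𝔑.G ^ 2 ≤ 𝔑.G ^ 18 := pow_le_pow_right₀ 𝔑.hG (by norm_num)
  have h2 := 𝔑.hGη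
  rw [le_div_iff₀ (by norm_num)]
  nlinarith [𝔑.hη0, mul_le_mul_of_nonneg_right h1 𝔑.hη0.le]

/-- The basic small parameter `u = η^{1/6} = δ^{1/(6·10^m)}`; the threshold of `F_i` is `t = u²`
and the final error is `O(G³ u)`. [cite: FordGreenKonyaginMaynardTao2018, §5 (definition of `F_i`)] -/
def u : ℝ := 𝔑.η ^ (1 / 6 : ℝ)

/-- [cite: FordGreenKonyaginMaynardTao2018, §5 (definition of `F_i`)] -/
theorem u_pos : 0 < 𝔑.u := Real.rpow_pos_of_pos 𝔑.hη0 _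

/-- [cite: FordGreenKonyaginMaynardTao2018, §5 (definition of `F_i`)] -/
theorem u_pow_six : 𝔑.u ^ 6 = 𝔑.η := by
  rw [u, show (1 / 6 : ℝ) = ((6 : ℕ) : ℝ)⁻¹ by norm_num]
  exact Real.rpow_inv_natCast_pow 𝔑.hη0.le (by norm_num)

/-- The threshold `t = δ^{1/(3·10^m)} = η^{1/3} = u²` of the event `F_i` ((5.3)).
[cite: FordGreenKonyaginMaynardTao2018, §5 (definition of `F_i`)] -/
def t : ℝ := 𝔑.u ^ 2

/-- [cite: FordGreenKonyaginMaynardTao2018, §5 (definition of `F_i`)] -/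
theorem t_pos : 0 < 𝔑.t := pow_pos 𝔑.u_pos 2

/-- [cite: FordGreenKonyaginMaynardTao2018, §5 (definition of `F_i`)] -/
theorem t_pow_three : 𝔑.t ^ 3 = 𝔑.η := by
  rw [t, ← pow_mul]; exact 𝔑.u_pow_six

/-- [cite: FordGreenKonyaginMaynardTao2018, §5 (definition of `F_i`)] -/
theorem t_le : 𝔑.t ≤ 1 / 10 ^ 4 := by
  have h : 𝔑.t ^ 3 ≤ (1 / 10 ^ 4 : ℝ) ^ 3 := by
    rw [t_pow_three]; exact 𝔑.η_le.trans (by norm_num)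
  exact le_of_pow_le_pow_left₀ (by norm_num) (by norm_num) h

/-- [cite: FordGreenKonyaginMaynardTao2018, §5 (definition of `F_i`)] -/
theorem t_le_half : 𝔑.t ≤ 1 / 2 := 𝔑.t_le.trans (by norm_num)

/-- [cite: FordGreenKonyaginMaynardTao2018, §5 (definition of `F_i`)] -/
theorem η_le_t : 𝔑.η ≤ 𝔑.t := by
  rw [← t_pow_three]
  exact pow_le_of_le_one 𝔑.t_pos.le (𝔑.t_le_half.trans (by norm_num)) (by norm_num)

/-! ### Expectations over the previous stage -/

/-- `E f = ∑_ω Λ(ω) f(ω)`. [cite: FordGreenKonyaginMaynardTao2018, §4.2 (laws in place of random variables)] -/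
def E (f : Ω → ℝ) : ℝ := ∑ ω, 𝔑.Λ ω * f ω

/-- The indicator of `e ⊆ 𝐖`. [cite: FordGreenKonyaginMaynardTao2018, §5 (5.2)] -/
def ind (e : Finset V) (ω : Ω) : ℝ := if e ⊆ 𝔑.W ω then 1 else 0

/-- [cite: FordGreenKonyaginMaynardTao2018, §4.2] -/
theorem Λ_nonneg (ω : Ω) : 0 ≤ 𝔑.Λ ω := 𝔑.hΛ.1 ω

/-- [cite: FordGreenKonyaginMaynardTao2018, §4.2] -/
theorem E_one : 𝔑.E (fun _ => 1) = 1 := by simp [E, 𝔑.hΛ.2]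

/-- [cite: FordGreenKonyaginMaynardTao2018, §4.2] -/
theorem E_mono {f g : Ω → ℝ} (h : ∀ ω, f ω ≤ g ω) : 𝔑.E f ≤ 𝔑.E g :=
  Finset.sum_le_sum fun ω _ => mul_le_mul_of_nonneg_left (h ω) (𝔑.Λ_nonneg ω)

/-- [cite: FordGreenKonyaginMaynardTao2018, §4.2] -/
theorem E_nonneg {f : Ω → ℝ} (h : ∀ ω, 0 ≤ f ω) : 0 ≤ 𝔑.E f :=
  Finset.sum_nonneg fun ω _ => mul_nonneg (𝔑.Λ_nonneg ω) (h ω)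

/-- [cite: FordGreenKonyaginMaynardTao2018, §4.2] -/
theorem E_mul_left (c : ℝ) (f : Ω → ℝ) : 𝔑.E (fun ω => c * f ω) = c * 𝔑.E f := by
  simp only [E, Finset.mul_sum]
  exact Finset.sum_congr rfl fun ω _ => by ring

/-- [cite: FordGreenKonyaginMaynardTao2018, §4.2] -/
theorem E_add (f g : Ω → ℝ) : 𝔑.E (fun ω => f ω + g ω) = 𝔑.E f + 𝔑.E g := by
  simp only [E, mul_add, Finset.sum_add_distrib]

/-- [cite: FordGreenKonyaginMaynardTao2018, §4.2] -/
theorem E_sub (f g : Ω → ℝ) : 𝔑.E (fun ω => f ω - g ω) = 𝔑.E f - 𝔑.E g := by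
  simp only [E, mul_sub, Finset.sum_sub_distrib]

/-- [cite: FordGreenKonyaginMaynardTao2018, §4.2] -/
theorem E_sum {β : Type*} (s : Finset β) (f : β → Ω → ℝ) :
    𝔑.E (fun ω => ∑ b ∈ s, f b ω) = ∑ b ∈ s, 𝔑.E (f b) := by
  simp only [E, Finset.mul_sum]
  exact Finset.sum_comm

/-- The mass of an event is the expectation of its indicator. [cite: FordGreenKonyaginMaynardTao2018, §4.2] -/
theorem mass_eq_E (A : Ω → Prop) [DecidablePred A] :
    ∑ ω ∈ univ.filter A, 𝔑.Λ ω = 𝔑.E (fun ω => if A ω then 1 else 0) := by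
  rw [E, Finset.sum_filter]
  exact Finset.sum_congr rfl fun ω _ => by split_ifs <;> simp

/-- [cite: FordGreenKonyaginMaynardTao2018, §5 (5.2)] -/
theorem ind_nonneg (e : Finset V) (ω : Ω) : 0 ≤ 𝔑.ind e ω := by
  unfold ind; split_ifs <;> norm_num

/-- [cite: FordGreenKonyaginMaynardTao2018, §5 (5.2)] -/
theorem ind_le_one (e : Finset V) (ω : Ω) : 𝔑.ind e ω ≤ 1 := by
  unfold ind; split_ifs <;> norm_num

/-- `1_{S ⊆ 𝐖} 1_{S' ⊆ 𝐖} = 1_{S ∪ S' ⊆ 𝐖}`. [cite: FordGreenKonyaginMaynardTao2018, §5 proof of Lemma 5.1] -/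
theorem ind_mul_ind (S S' : Finset V) (ω : Ω) : 𝔑.ind S ω * 𝔑.ind S' ω = 𝔑.ind (S ∪ S') ω := by
  unfold ind
  by_cases h : S ⊆ 𝔑.W ω <;> by_cases h' : S' ⊆ 𝔑.W ω <;>
    simp [h, h', Finset.union_subset_iff]

/-- The induction hypothesis (5.2), upper side. [cite: FordGreenKonyaginMaynardTao2018, §5 (5.2)] -/
theorem E_ind_le {e : Finset V} (he : (#e : ℝ) ≤ 𝔑.s + 2 * 𝔑.r) :
    𝔑.E (𝔑.ind e) ≤ (1 + 𝔑.η) * 𝔑.P e := by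
  have h := (abs_le.1 (𝔑.hhyp e he)).2
  unfold E ind P; linarith

/-- The induction hypothesis (5.2), lower side. [cite: FordGreenKonyaginMaynardTao2018, §5 (5.2)] -/
theorem le_E_ind {e : Finset V} (he : (#e : ℝ) ≤ 𝔑.s + 2 * 𝔑.r) :
    (1 - 𝔑.η) * 𝔑.P e ≤ 𝔑.E (𝔑.ind e) := by
  have h := (abs_le.1 (𝔑.hhyp e he)).1
  unfold E ind P; linarith

/-- [cite: FordGreenKonyaginMaynardTao2018, §5 (5.2)] -/
theorem abs_E_ind_sub_le {e : Finset V} (he : (#e : ℝ) ≤ 𝔑.s + 2 * 𝔑.r) :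
    |𝔑.E (𝔑.ind e) - 𝔑.P e| ≤ 𝔑.η * 𝔑.P e := by
  have h := 𝔑.hhyp e he
  unfold E ind P; exact h

/-! ### The normalisation factor `X_i(W)` and Lemma 5.1 -/

/-- `X_i(W) := E(1_{𝐞_i ⊆ W}/P_{m−1}(𝐞_i)) = ∑_{ẽ ⊆ W} P(𝐞_i = ẽ)/P_{m−1}(ẽ)`.
[cite: FordGreenKonyaginMaynardTao2018, §5 (definition of `X_i(W)`)] -/
def X (i : ι) (W : Finset V) : ℝ := ∑ S, if S ⊆ W then 𝔑.μ i S / 𝔑.P S else 0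

/-- [cite: FordGreenKonyaginMaynardTao2018, §5 (definition of `X_i(W)`)] -/
theorem X_eq (i : ι) (W : Finset V) :
    𝔑.X i W = ∑ S, 𝔑.μ i S / 𝔑.P S * (if S ⊆ W then 1 else 0) :=
  Finset.sum_congr rfl fun S _ => by split_ifs <;> simp

/-- [cite: FordGreenKonyaginMaynardTao2018, §5 (definition of `X_i(W)`)] -/
theorem X_nonneg {i : ι} (hi : i ∈ 𝔑.T) (W : Finset V) : 0 ≤ 𝔑.X i W :=
  Finset.sum_nonneg fun S _ => by
    split_ifs
    · exact div_nonneg (𝔑.μ_nonneg hi S) (𝔑.P_pos S).le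
    · exact le_rfl

/-- `E X_i(𝐖) = ∑_ẽ P(𝐞_i = ẽ) P(ẽ ⊆ 𝐖)/P_{m−1}(ẽ)`.
[cite: FordGreenKonyaginMaynardTao2018, §5 proof of (5.4) in Lemma 5.1] -/
theorem E_X_eq (i : ι) :
    𝔑.E (fun ω => 𝔑.X i (𝔑.W ω)) = ∑ S, 𝔑.μ i S / 𝔑.P S * 𝔑.E (𝔑.ind S) := by
  simp_rw [X_eq]
  rw [𝔑.E_sum]
  exact Finset.sum_congr rfl fun S _ => by rw [𝔑.E_mul_left]; rfl

/-- **Lemma 5.1, first moment (5.4):** `E X_i(𝐖) = 1 + O_≤(δ^{1/10^m})`.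
[cite: FordGreenKonyaginMaynardTao2018, Lemma 5.1, (5.4)] -/
theorem abs_E_X_sub_one_le {i : ι} (hi : i ∈ 𝔑.T) :
    |𝔑.E (fun ω => 𝔑.X i (𝔑.W ω)) - 1| ≤ 𝔑.η := by
  rw [E_X_eq, ← 𝔑.μ_sum hi]
  have hterm : ∀ S : Finset V,
      |𝔑.μ i S / 𝔑.P S * 𝔑.E (𝔑.ind S) - 𝔑.μ i S| ≤ 𝔑.μ i S * 𝔑.η := by
    intro S
    by_cases hS : 𝔑.μ i S = 0
    · simp [hS]
    · have hP := 𝔑.P_pos S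
      have hcard : (#S : ℝ) ≤ 𝔑.s + 2 * 𝔑.r := by
        have := 𝔑.hsize i hi S hS; linarith [𝔑.hs, 𝔑.hr]
      have h := 𝔑.abs_E_ind_sub_le hcard
      rw [show 𝔑.μ i S / 𝔑.P S * 𝔑.E (𝔑.ind S) - 𝔑.μ i S =
          𝔑.μ i S / 𝔑.P S * (𝔑.E (𝔑.ind S) - 𝔑.P S) by field_simp, abs_mul,
        abs_of_nonneg (div_nonneg (𝔑.μ_nonneg hi S) hP.le)]
      calc 𝔑.μ i S / 𝔑.P S * |𝔑.E (𝔑.ind S) - 𝔑.P S|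
          ≤ 𝔑.μ i S / 𝔑.P S * (𝔑.η * 𝔑.P S) :=
            mul_le_mul_of_nonneg_left h (div_nonneg (𝔑.μ_nonneg hi S) hP.le)
        _ = 𝔑.μ i S * 𝔑.η := by field_simp
  rw [← Finset.sum_sub_distrib]
  refine (Finset.abs_sum_le_sum_abs _ _).trans ?_
  calc ∑ S, |𝔑.μ i S / 𝔑.P S * 𝔑.E (𝔑.ind S) - 𝔑.μ i S| ≤ ∑ S, 𝔑.μ i S * 𝔑.η :=
        Finset.sum_le_sum fun S _ => hterm S
    _ = 𝔑.η := by rw [← Finset.sum_mul, 𝔑.μ_sum hi, one_mul]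

/-- `E X_i(𝐖)² = ∑_{ẽ, ê} P(𝐞_i = ẽ) P(𝐞_i = ê) P(ẽ ∪ ê ⊆ 𝐖)/(P_{m−1}(ẽ) P_{m−1}(ê))`.
[cite: FordGreenKonyaginMaynardTao2018, §5 proof of (5.5) in Lemma 5.1] -/
theorem E_X_sq_eq (i : ι) :
    𝔑.E (fun ω => 𝔑.X i (𝔑.W ω) ^ 2) =
      ∑ S, ∑ S', 𝔑.μ i S / 𝔑.P S * (𝔑.μ i S' / 𝔑.P S') * 𝔑.E (𝔑.ind (S ∪ S')) := by
  have h : ∀ ω, 𝔑.X i (𝔑.W ω) ^ 2 =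
      ∑ S, ∑ S', 𝔑.μ i S / 𝔑.P S * (𝔑.μ i S' / 𝔑.P S') * 𝔑.ind (S ∪ S') ω := by
    intro ω
    rw [X_eq, sq, Finset.sum_mul_sum]
    refine Finset.sum_congr rfl fun S _ => Finset.sum_congr rfl fun S' _ => ?_
    rw [← 𝔑.ind_mul_ind]; unfold ind; ring
  simp_rw [h]
  rw [𝔑.E_sum]
  refine Finset.sum_congr rfl fun S _ => ?_
  rw [𝔑.E_sum]
  refine Finset.sum_congr rfl fun S' _ => ?_
  rw [𝔑.E_mul_left]

/-- **Lemma 5.1, second moment (5.5):**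
`E X_i(𝐖)² ≤ (1 + δ^{1/10^m})(1 + κ^{-r} r δ)` («by (4.6), (4.7) and a union bound»).
[cite: FordGreenKonyaginMaynardTao2018, Lemma 5.1, (5.5)] -/
theorem E_X_sq_le {i : ι} (hi : i ∈ 𝔑.T) :
    𝔑.E (fun ω => 𝔑.X i (𝔑.W ω) ^ 2) ≤ (1 + 𝔑.η) * (1 + 𝔑.θ⁻¹ * 𝔑.r * 𝔑.δ) := by
  rw [E_X_sq_eq]
  have hη1 : 0 ≤ 1 + 𝔑.η := by linarith [𝔑.hη0]
  have hθi : 0 ≤ 𝔑.θ⁻¹ := inv_nonneg.2 𝔑.hθ0.le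
  -- termwise bound
  have hterm : ∀ S S' : Finset V,
      𝔑.μ i S / 𝔑.P S * (𝔑.μ i S' / 𝔑.P S') * 𝔑.E (𝔑.ind (S ∪ S')) ≤
        (1 + 𝔑.η) * (𝔑.μ i S * (𝔑.μ i S' * (1 + 𝔑.θ⁻¹ * #(S' ∩ S)))) := by
    intro S S'
    by_cases hS : 𝔑.μ i S = 0
    · simp [hS]
    by_cases hS' : 𝔑.μ i S' = 0
    · simp [hS']
    have hPS := 𝔑.P_pos S
    have hPS' := 𝔑.P_pos S'
    have hPI := 𝔑.P_pos (S ∩ S')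
    have hcard : (#(S ∪ S') : ℝ) ≤ 𝔑.s + 2 * 𝔑.r := by
      have h1 := 𝔑.hsize i hi S hS
      have h2 := 𝔑.hsize i hi S' hS'
      have h3 : (#(S ∪ S') : ℝ) ≤ #S + #S' := by exact_mod_cast Finset.card_union_le S S'
      linarith [𝔑.hs]
    have hE := 𝔑.E_ind_le hcard
    have hU : 𝔑.P (S ∪ S') = 𝔑.P S * 𝔑.P S' / 𝔑.P (S ∩ S') := by
      rw [eq_div_iff hPI.ne']; exact 𝔑.P_union_inter S S'
    have hinv : 1 / 𝔑.P (S ∩ S') ≤ 1 + 𝔑.θ⁻¹ * #(S' ∩ S) := by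
      rw [Finset.inter_comm S' S]
      exact inv_pw_le_one_add 𝔑.hθ0 (𝔑.θ_le_P hi hS Finset.inter_subset_left)
    have hcoef : 0 ≤ 𝔑.μ i S / 𝔑.P S * (𝔑.μ i S' / 𝔑.P S') :=
      mul_nonneg (div_nonneg (𝔑.μ_nonneg hi S) hPS.le) (div_nonneg (𝔑.μ_nonneg hi S') hPS'.le)
    calc 𝔑.μ i S / 𝔑.P S * (𝔑.μ i S' / 𝔑.P S') * 𝔑.E (𝔑.ind (S ∪ S'))
        ≤ 𝔑.μ i S / 𝔑.P S * (𝔑.μ i S' / 𝔑.P S') * ((1 + 𝔑.η) * 𝔑.P (S ∪ S')) :=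
          mul_le_mul_of_nonneg_left hE hcoef
      _ = (1 + 𝔑.η) * (𝔑.μ i S * (𝔑.μ i S' * (1 / 𝔑.P (S ∩ S')))) := by
          rw [hU]; field_simp
      _ ≤ (1 + 𝔑.η) * (𝔑.μ i S * (𝔑.μ i S' * (1 + 𝔑.θ⁻¹ * #(S' ∩ S)))) := by
          refine mul_le_mul_of_nonneg_left (mul_le_mul_of_nonneg_left
            (mul_le_mul_of_nonneg_left hinv (𝔑.μ_nonneg hi S')) (𝔑.μ_nonneg hi S)) hη1
  -- summing
  have hinner : ∀ S : Finset V,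
      ∑ S', 𝔑.μ i S' * (1 + 𝔑.θ⁻¹ * #(S' ∩ S)) ≤ 1 + 𝔑.θ⁻¹ * 𝔑.r * 𝔑.δ ∨ 𝔑.μ i S = 0 := by
    intro S
    by_cases hS : 𝔑.μ i S = 0
    · exact Or.inr hS
    refine Or.inl ?_
    have hsplit : ∑ S', 𝔑.μ i S' * (1 + 𝔑.θ⁻¹ * #(S' ∩ S)) =
        ∑ S', 𝔑.μ i S' + 𝔑.θ⁻¹ * ∑ S', 𝔑.μ i S' * #(S' ∩ S) := by
      rw [Finset.mul_sum, ← Finset.sum_add_distrib]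
      exact Finset.sum_congr rfl fun S' _ => by ring
    rw [hsplit, 𝔑.μ_sum hi, sum_mul_card_inter]
    have hd : ∑ v ∈ S, probMem (𝔑.μ i) v ≤ 𝔑.r * 𝔑.δ :=
      calc ∑ v ∈ S, probMem (𝔑.μ i) v ≤ ∑ _v ∈ S, 𝔑.δ :=
            Finset.sum_le_sum fun v _ => 𝔑.hsparse i hi v
        _ = #S * 𝔑.δ := by rw [Finset.sum_const, nsmul_eq_mul]
        _ ≤ 𝔑.r * 𝔑.δ := mul_le_mul_of_nonneg_right (𝔑.hsize i hi S hS) 𝔑.hδ.le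
    nlinarith [mul_le_mul_of_nonneg_left hd hθi]
  calc ∑ S, ∑ S', 𝔑.μ i S / 𝔑.P S * (𝔑.μ i S' / 𝔑.P S') * 𝔑.E (𝔑.ind (S ∪ S'))
      ≤ ∑ S, ∑ S', (1 + 𝔑.η) * (𝔑.μ i S * (𝔑.μ i S' * (1 + 𝔑.θ⁻¹ * #(S' ∩ S)))) :=
        Finset.sum_le_sum fun S _ => Finset.sum_le_sum fun S' _ => hterm S S'
    _ = (1 + 𝔑.η) * ∑ S, 𝔑.μ i S * ∑ S', 𝔑.μ i S' * (1 + 𝔑.θ⁻¹ * #(S' ∩ S)) := by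
        rw [Finset.mul_sum]
        refine Finset.sum_congr rfl fun S _ => ?_
        rw [Finset.mul_sum, Finset.mul_sum]
    _ ≤ (1 + 𝔑.η) * ∑ S, 𝔑.μ i S * (1 + 𝔑.θ⁻¹ * 𝔑.r * 𝔑.δ) := by
        refine mul_le_mul_of_nonneg_left (Finset.sum_le_sum fun S _ => ?_) hη1
        rcases hinner S with h | h
        · exact mul_le_mul_of_nonneg_left h (𝔑.μ_nonneg hi S)
        · simp [h]
    _ = (1 + 𝔑.η) * (1 + 𝔑.θ⁻¹ * 𝔑.r * 𝔑.δ) := by rw [← Finset.sum_mul, 𝔑.μ_sum hi, one_mul]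

/-- **Lemma 5.1, variance:** `E (X_i(𝐖) − 1)² ≤ 3η + 2κ^{-r} r δ`.
[cite: FordGreenKonyaginMaynardTao2018, Lemma 5.1] -/
theorem E_X_var_le {i : ι} (hi : i ∈ 𝔑.T) :
    𝔑.E (fun ω => (𝔑.X i (𝔑.W ω) - 1) ^ 2) ≤ 3 * 𝔑.η + 2 * (𝔑.θ⁻¹ * 𝔑.r * 𝔑.δ) := by
  have h1 := 𝔑.E_X_sq_le hi
  have h2 := (abs_le.1 (𝔑.abs_E_X_sub_one_le hi)).1
  have hsplit : 𝔑.E (fun ω => (𝔑.X i (𝔑.W ω) - 1) ^ 2) =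
      𝔑.E (fun ω => 𝔑.X i (𝔑.W ω) ^ 2) - 2 * 𝔑.E (fun ω => 𝔑.X i (𝔑.W ω)) + 1 := by
    have h3 : ∑ ω, 𝔑.Λ ω = 1 := 𝔑.hΛ.2
    simp only [E]
    calc ∑ ω, 𝔑.Λ ω * (𝔑.X i (𝔑.W ω) - 1) ^ 2
        = ∑ ω, (𝔑.Λ ω * 𝔑.X i (𝔑.W ω) ^ 2 - 2 * (𝔑.Λ ω * 𝔑.X i (𝔑.W ω)) + 𝔑.Λ ω) :=
          Finset.sum_congr rfl fun ω _ => by ring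
      _ = ∑ ω, 𝔑.Λ ω * 𝔑.X i (𝔑.W ω) ^ 2 - 2 * ∑ ω, 𝔑.Λ ω * 𝔑.X i (𝔑.W ω) + ∑ ω, 𝔑.Λ ω := by
          rw [Finset.sum_add_distrib, Finset.sum_sub_distrib, Finset.mul_sum]
      _ = _ := by rw [h3]
  rw [hsplit]
  have ha : 0 ≤ 𝔑.θ⁻¹ * 𝔑.r * 𝔑.δ :=
    mul_nonneg (mul_nonneg (inv_nonneg.2 𝔑.hθ0.le) (by linarith [𝔑.hr])) 𝔑.hδ.le
  nlinarith [𝔑.η_le_one, 𝔑.hη0]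

/-- The probability bound `φ` for the failure of `F_i` (Lemma 5.1: `P(F_i fails) = O(δ^{1/(3·10^m)})`).
[cite: FordGreenKonyaginMaynardTao2018, Lemma 5.1] -/
def φ : ℝ := (3 * 𝔑.η + 2 * (𝔑.θ⁻¹ * 𝔑.r * 𝔑.δ)) / 𝔑.t ^ 2

/-- [cite: FordGreenKonyaginMaynardTao2018, Lemma 5.1] -/
theorem φ_nonneg : 0 ≤ 𝔑.φ :=
  div_nonneg (by
    have : 0 ≤ 𝔑.θ⁻¹ * 𝔑.r * 𝔑.δ :=
      mul_nonneg (mul_nonneg (inv_nonneg.2 𝔑.hθ0.le) (by linarith [𝔑.hr])) 𝔑.hδ.le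
    linarith [𝔑.hη0]) (sq_nonneg _)

/-- **Lemma 5.1:** `P(F_i(𝐖) fails) ≤ φ = (3η + 2κ^{-r}rδ)/t²`, `t = δ^{1/(3·10^m)}` (Chebyshev).
[cite: FordGreenKonyaginMaynardTao2018, Lemma 5.1] -/
theorem mass_not_F_le {i : ι} (hi : i ∈ 𝔑.T) :
    ∑ ω ∈ univ.filter (fun ω => 𝔑.t < |𝔑.X i (𝔑.W ω) - 1|), 𝔑.Λ ω ≤ 𝔑.φ := by
  refine (weighted_chebyshev univ (fun ω => 𝔑.X i (𝔑.W ω)) 1 𝔑.t_pos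
    (fun ω _ => 𝔑.Λ_nonneg ω)).trans ?_
  exact div_le_div_of_nonneg_right (𝔑.E_X_var_le hi) (sq_nonneg _)

/-! ### The conditional laws `q_i(· | W)` of the `𝐞'_i` -/

/-- The conditional law of `𝐞'_i` given `𝐖 = W` ((5.3) and the preceding display): if `F_i(W)` holds,
`P(𝐞'_i = ẽ | 𝐖 = W) = 1_{ẽ ⊆ W} P(𝐞_i = ẽ)/(X_i(W) P_{m−1}(ẽ))`; if `F_i(W)` fails, `𝐞'_i = ∅`.
[cite: FordGreenKonyaginMaynardTao2018, §5 (definition of `𝐞'_i`, display before Lemma 5.1)] -/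
def q (W : Finset V) (i : ι) (S : Finset V) : ℝ :=
  if |𝔑.X i W - 1| ≤ 𝔑.t then (if S ⊆ W then 𝔑.μ i S / (𝔑.P S * 𝔑.X i W) else 0)
  else (if S = ∅ then 1 else 0)

/-- On `F_i(W)`: `X_i(W) ≥ 1 − t ≥ 1/2`. [cite: FordGreenKonyaginMaynardTao2018, §5 (definition of `F_i`)] -/
theorem half_le_X {i : ι} {W : Finset V} (hF : |𝔑.X i W - 1| ≤ 𝔑.t) : 1 / 2 ≤ 𝔑.X i W := by
  have h := (abs_le.1 hF).1
  linarith [𝔑.t_le_half]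

/-- [cite: FordGreenKonyaginMaynardTao2018, §5 (definition of `𝐞'_i`)] -/
theorem q_of_F {i : ι} {W : Finset V} (hF : |𝔑.X i W - 1| ≤ 𝔑.t) (S : Finset V) :
    𝔑.q W i S = if S ⊆ W then 𝔑.μ i S / (𝔑.P S * 𝔑.X i W) else 0 := by
  simp [q, hF]

/-- [cite: FordGreenKonyaginMaynardTao2018, §5 (definition of `𝐞'_i`)] -/
theorem q_of_not_F {i : ι} {W : Finset V} (hF : ¬ |𝔑.X i W - 1| ≤ 𝔑.t) (S : Finset V) :
    𝔑.q W i S = if S = ∅ then 1 else 0 := by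
  simp [q, hF]

/-- [cite: FordGreenKonyaginMaynardTao2018, §5 (definition of `𝐞'_i`)] -/
theorem q_nonneg {i : ι} (hi : i ∈ 𝔑.T) (W S : Finset V) : 0 ≤ 𝔑.q W i S := by
  unfold q
  split_ifs with hF
  · exact div_nonneg (𝔑.μ_nonneg hi S)
      (mul_nonneg (𝔑.P_pos S).le (by linarith [𝔑.half_le_X hF]))
  · exact le_rfl
  · exact zero_le_one
  · exact le_rfl

/-- `q_i(· | W)` is a probability law («(5.3) defines a probability distribution»).
[cite: FordGreenKonyaginMaynardTao2018, §5 (definition of `𝐞'_i`)] -/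
theorem q_sum (i : ι) (W : Finset V) : ∑ S, 𝔑.q W i S = 1 := by
  by_cases hF : |𝔑.X i W - 1| ≤ 𝔑.t
  · simp_rw [𝔑.q_of_F hF]
    have hX : 0 < 𝔑.X i W := by linarith [𝔑.half_le_X hF]
    have h : ∑ S, (if S ⊆ W then 𝔑.μ i S / (𝔑.P S * 𝔑.X i W) else 0) =
        (∑ S, if S ⊆ W then 𝔑.μ i S / 𝔑.P S else 0) / 𝔑.X i W := by
      rw [Finset.sum_div]
      exact Finset.sum_congr rfl fun S _ => by
        split_ifs
        · rw [div_div]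
        · simp
    rw [h]
    exact div_self hX.ne'
  · simp_rw [𝔑.q_of_not_F hF]
    rw [Finset.sum_ite_eq' univ (∅ : Finset V)]
    simp

/-- [cite: FordGreenKonyaginMaynardTao2018, §5 (definition of `𝐞'_i`)] -/
theorem q_isLaw {i : ι} (hi : i ∈ 𝔑.T) (W : Finset V) : IsLaw (𝔑.q W i) :=
  ⟨𝔑.q_nonneg hi W, 𝔑.q_sum i W⟩

/-- (a): the essential range of `𝐞'_i` is inside that of `𝐞_i`, union `{∅}`.
[cite: FordGreenKonyaginMaynardTao2018, Theorem 3 (a)] -/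
theorem q_support {i : ι} {W S : Finset V} (h : 𝔑.q W i S ≠ 0) : S = ∅ ∨ 𝔑.μ i S ≠ 0 := by
  unfold q at h
  split_ifs at h with hF hS hS0
  · right
    intro h0
    apply h
    simp [h0]
  · exact absurd rfl h
  · exact Or.inl hS0
  · exact absurd rfl h

/-- On `F_i(W)`: `P(𝐞'_i = ẽ | W) ≤ 2κ^{-r} P(𝐞_i = ẽ)` («by (5.3), `X_i ≥ 1/2` and (5.1)»).
[cite: FordGreenKonyaginMaynardTao2018, §5 («`P(v ∈ 𝐞'_i | 𝐖 = W) ≪ κ^{-r} P(v ∈ 𝐞_i)`»)] -/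
theorem q_le {i : ι} (hi : i ∈ 𝔑.T) {W : Finset V} (hF : |𝔑.X i W - 1| ≤ 𝔑.t) (S : Finset V) :
    𝔑.q W i S ≤ 2 * 𝔑.θ⁻¹ * 𝔑.μ i S := by
  rw [𝔑.q_of_F hF]
  have hθi : 0 ≤ 𝔑.θ⁻¹ := inv_nonneg.2 𝔑.hθ0.le
  split_ifs with hSW
  · by_cases hS : 𝔑.μ i S = 0
    · simp [hS]
    · have hX := 𝔑.half_le_X hF
      have hθP := 𝔑.θ_le_P hi hS (subset_refl S)
      have hμ := 𝔑.μ_nonneg hi S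
      rw [div_le_iff₀ (mul_pos (𝔑.P_pos S) (by linarith))]
      -- `μ ≤ 2θ⁻¹ μ · P · X` since `P X ≥ θ/2`
      have h1 : 𝔑.θ * (1 / 2) ≤ 𝔑.P S * 𝔑.X i W :=
        mul_le_mul hθP hX (by norm_num) (𝔑.P_pos S).le
      have hθne : 𝔑.θ ≠ 0 := 𝔑.hθ0.ne'
      calc 𝔑.μ i S = 2 * 𝔑.θ⁻¹ * 𝔑.μ i S * (𝔑.θ * (1 / 2)) := by
            field_simp
        _ ≤ 2 * 𝔑.θ⁻¹ * 𝔑.μ i S * (𝔑.P S * 𝔑.X i W) :=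
            mul_le_mul_of_nonneg_left h1 (by positivity)
  · exact mul_nonneg (mul_nonneg (by norm_num) hθi) (𝔑.μ_nonneg hi S)

/-- On `F_i(W)`, for `S ⊆ W`: `q = (1/X) P(𝐞_i = S)/P(S)`. [cite: FordGreenKonyaginMaynardTao2018, §5 (5.3)] -/
theorem q_eq_of_F {i : ι} {W : Finset V} (hF : |𝔑.X i W - 1| ≤ 𝔑.t) (S : Finset V) :
    𝔑.q W i S = 1 / 𝔑.X i W * (if S ⊆ W then 𝔑.μ i S / 𝔑.P S else 0) := by
  rw [𝔑.q_of_F hF]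
  split_ifs
  · have hX : 0 < 𝔑.X i W := by linarith [𝔑.half_le_X hF]
    field_simp
  · simp

end NibbleData

end FGKMTCovering

end Literature.Combinatorics.Hypergraph
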